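import Summits.ValiantsHypothesis.ValiantsHypothesis.Theses.ValuativeGCT
import Literature.NumberTheory.DiophantineGeometry.GLPolynomialRepSemisimpleProofs
import Literature.NumberTheory.DiophantineGeometry.GLHighestWeightExistsUniqueProofs
import Literature.NumberTheory.DiophantineGeometry.GLHighestWeightDominanceProofs
import Literature.NumberTheory.DiophantineGeometry.GLHighestWeightMultiplicityProofs
import Literature.NumberTheory.DiophantineGeometry.GLHighestWeightFacts
import Literature.Computability.AlgebraicComplexity.CoordRepRational
import Literature.Computability.AlgebraicComplexity.OrbitClosureWeights
import Summits.ValiantsHypothesis.ValiantsHypothesis.Theorems.CutBites.Negative.NoCutForColumnCompression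

/-!
# `ValuativeGCT.CutBites` (stmt-ValiantsHypothesis-12626), line adjugate-pfaffian-kernel — Stub 7 `stub_hwExtraction`

Highest-weight extraction (shared by every `CutBites` line): an `H`-invariant form `G` of degree `D` on
`End(ℂ^{m×m})` (`H = {M | linSubst M det_m = det_m}` acting by `X (j,i) ↦ Σ_l M l i • X (j,l)`) not vanishing on
`L_U = {all rows in U}` yields `λ ⊢ D` (`≤ m²` parts) and an `H`-invariant `B`-semi-invariant form `G'` of degree `D`
and weight `(dualOfPartition (m*m) λ).toMatIdx` for the Borel action `X (j,i) ↦ Σ_l (g⁻¹) j l • X (l,i)` (the crux's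
clause verbatim), again non-vanishing on `L_U`.  Proof: `V = Hom_D ⊓ H-invariants` is a finite-dimensional rational
`GL (MatIdx m)`-module (left/right actions commute; coefficients polynomial in `g⁻¹`,
`isRationalRep_of_forall_exists_eval_inv`); `V ⊓ I(L_U)` is stable; complete reducibility
(`isSemisimpleRepresentation_of_isRationalRep_holds`) + Lie–Kolchin (`exists_hasHighestWeight_of_isRationalRep`) give a
`B`-eigenvector outside it; dominance (`isDominant_of_mem_highestWeightSpace`); torus weights of monomials give
`χ = -(row degrees) ≤ 0` of size `-D`; `Weight.exists_eq_dualOfPartition_comp_of_nonpos` names `λ`.  No definitions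
(the representation is built inside the proof); all facts used are discharged in tree. [folklore]
-/

namespace Summit.ValiantsHypothesis.ValiantsHypothesis.Theorems.CutBitesAdjugate

open Literature.NumberTheory.DiophantineGeometry Literature.Computability.AlgebraicComplexity
open MvPolynomial
open scoped BigOperators Matrix

-- `Summit.ValiantsHypothesis.ValiantsHypothesis.…` is the tree's mandated single-conjunct layout (Sub = Summit).
set_option linter.dupNamespace false

/-- **Highest-weight vectors outside a stable proper subspace.** In a finite-dimensional rational representation of
`GL σ ℂ`, every `GL`-stable submodule `N ≠ ⊤` misses some `B`-semi-invariant vector: a stable complement of `N`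
(`isSemisimpleRepresentation_of_isRationalRep_holds`) is a non-zero rational representation, so it has a highest-weight
vector (`exists_hasHighestWeight_of_isRationalRep`), which is not in `N`. Goodman–Wallach §3.3, §4.2.5. [folklore] -/
theorem hwx_exists_mem_highestWeightSpace_not_mem {σ : Type*} [Fintype σ] [LinearOrder σ]
    {V : Type*} [AddCommGroup V] [Module ℂ V] [FiniteDimensional ℂ V]
    (ρ : Representation ℂ (GL σ ℂ) V) (hρ : IsRationalRep ρ) (N : Submodule ℂ V)
    (hN : ∀ (g : GL σ ℂ), ∀ v ∈ N, ρ g v ∈ N) (hNtop : N ≠ ⊤) :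
    ∃ χ : Weight σ, ∃ v ∈ highestWeightSpace ρ χ, v ∉ N := by
  let Ns : Subrepresentation ρ := ⟨N, fun g _ hv => hN g _ hv⟩
  haveI : ρ.IsSemisimpleRepresentation := isSemisimpleRepresentation_of_isRationalRep_holds hρ
  obtain ⟨N', hc⟩ := exists_isCompl Ns
  have hinf : N ⊓ N'.toSubmodule = ⊥ := congrArg Subrepresentation.toSubmodule hc.inf_eq_bot
  have hsup : N ⊔ N'.toSubmodule = ⊤ := congrArg Subrepresentation.toSubmodule hc.sup_eq_top
  have hN' : N'.toSubmodule ≠ ⊥ := fun h => hNtop (by rw [h, sup_bot_eq] at hsup; exact hsup)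
  haveI : Nontrivial ↥N'.toSubmodule := (Submodule.nontrivial_iff_ne_bot).mpr hN'
  have hρ' : IsRationalRep N'.toRepresentation := hρ.toRepresentation N'
  obtain ⟨χ, hχ⟩ := exists_hasHighestWeight_of_isRationalRep N'.toRepresentation hρ'
  obtain ⟨v, hv0, hv⟩ := (hasHighestWeight_iff_exists _ _).mp hχ
  refine ⟨χ, (v : V), (mem_highestWeightSpace_toRepresentation_iff N' χ v).mp hv, fun hvN => hv0 ?_⟩
  have hmem : (v : V) ∈ N ⊓ N'.toSubmodule := ⟨hvN, v.2⟩
  rw [hinf, Submodule.mem_bot] at hmem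
  exact Subtype.ext hmem

section LeftAction

variable {m : ℕ}

/-- The left action of `1` is the identity. [folklore] -/
theorem hwx_leftAct_one (G : MvPolynomial (MatIdx m × MatIdx m) ℂ) :
    MvPolynomial.aeval (R := ℂ) (fun p : MatIdx m × MatIdx m =>
      ∑ l : MatIdx m, (1 : Matrix (MatIdx m) (MatIdx m) ℂ) p.1 l •
        (X (l, p.2) : MvPolynomial (MatIdx m × MatIdx m) ℂ)) G = G := by
  have h : MvPolynomial.aeval (R := ℂ) (fun p : MatIdx m × MatIdx m =>
      ∑ l : MatIdx m, (1 : Matrix (MatIdx m) (MatIdx m) ℂ) p.1 l •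
        (X (l, p.2) : MvPolynomial (MatIdx m × MatIdx m) ℂ)) = AlgHom.id ℂ _ := by
    refine MvPolynomial.algHom_ext fun p => ?_
    rw [aeval_X, AlgHom.id_apply, Finset.sum_eq_single p.1]
    · simp
    · exact fun l _ hl => by rw [Matrix.one_apply_ne (Ne.symm hl), zero_smul]
    · exact fun h => absurd (Finset.mem_univ _) h
  rw [h, AlgHom.id_apply]

/-- Composition of left actions: acting by `C` and then by `B` is acting by `C * B`. [folklore] -/
theorem hwx_leftAct_leftAct (B C : Matrix (MatIdx m) (MatIdx m) ℂ) (G : MvPolynomial (MatIdx m × MatIdx m) ℂ) :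
    MvPolynomial.aeval (R := ℂ) (fun p : MatIdx m × MatIdx m =>
      ∑ l : MatIdx m, B p.1 l • (X (l, p.2) : MvPolynomial (MatIdx m × MatIdx m) ℂ))
      (MvPolynomial.aeval (R := ℂ) (fun p : MatIdx m × MatIdx m =>
        ∑ l : MatIdx m, C p.1 l • (X (l, p.2) : MvPolynomial (MatIdx m × MatIdx m) ℂ)) G)
    = MvPolynomial.aeval (R := ℂ) (fun p : MatIdx m × MatIdx m =>
      ∑ l : MatIdx m, (C * B) p.1 l • (X (l, p.2) : MvPolynomial (MatIdx m × MatIdx m) ℂ)) G := by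
  have h : (MvPolynomial.aeval (R := ℂ) (fun p : MatIdx m × MatIdx m =>
        ∑ l : MatIdx m, B p.1 l • (X (l, p.2) : MvPolynomial (MatIdx m × MatIdx m) ℂ))).comp
      (MvPolynomial.aeval (R := ℂ) (fun p : MatIdx m × MatIdx m =>
        ∑ l : MatIdx m, C p.1 l • (X (l, p.2) : MvPolynomial (MatIdx m × MatIdx m) ℂ)))
      = MvPolynomial.aeval (R := ℂ) (fun p : MatIdx m × MatIdx m =>
        ∑ l : MatIdx m, (C * B) p.1 l • (X (l, p.2) : MvPolynomial (MatIdx m × MatIdx m) ℂ)) := by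
    refine MvPolynomial.algHom_ext fun p => ?_
    rw [AlgHom.comp_apply, aeval_X, aeval_X, map_sum]
    simp only [map_smul, aeval_X, Finset.smul_sum, smul_smul, Matrix.mul_apply, Finset.sum_smul]
    rw [Finset.sum_comm]
  exact AlgHom.congr_fun h G

/-- The left action preserves forms of each degree. [folklore] -/
theorem hwx_leftAct_isHomogeneous (B : Matrix (MatIdx m) (MatIdx m) ℂ) {G : MvPolynomial (MatIdx m × MatIdx m) ℂ}
    {D : ℕ} (hG : G.IsHomogeneous D) :
    (MvPolynomial.aeval (R := ℂ) (fun p : MatIdx m × MatIdx m =>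
      ∑ l : MatIdx m, B p.1 l • (X (l, p.2) : MvPolynomial (MatIdx m × MatIdx m) ℂ)) G).IsHomogeneous D := by
  have h1 : ∀ p : MatIdx m × MatIdx m,
      (∑ l : MatIdx m, B p.1 l • (X (l, p.2) : MvPolynomial (MatIdx m × MatIdx m) ℂ)).IsHomogeneous 1 :=
    fun p => (mem_homogeneousSubmodule 1 _).mp <| Submodule.sum_mem _ fun l _ =>
      Submodule.smul_mem _ _ ((mem_homogeneousSubmodule 1 _).mpr (isHomogeneous_X ℂ _))
  simpa using hG.aeval _ h1

/-- The left action commutes with the crux's right action `X (j,i) ↦ Σ_l M l i • X (j,l)`. [folklore] -/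
theorem hwx_leftAct_rightAct_comm (B M : Matrix (MatIdx m) (MatIdx m) ℂ) (G : MvPolynomial (MatIdx m × MatIdx m) ℂ) :
    MvPolynomial.aeval (R := ℂ) (fun p : MatIdx m × MatIdx m =>
      ∑ l : MatIdx m, B p.1 l • (X (l, p.2) : MvPolynomial (MatIdx m × MatIdx m) ℂ))
      (MvPolynomial.aeval (R := ℂ) (fun p : MatIdx m × MatIdx m =>
        ∑ l : MatIdx m, M l p.2 • (X (p.1, l) : MvPolynomial (MatIdx m × MatIdx m) ℂ)) G)
    = MvPolynomial.aeval (R := ℂ) (fun p : MatIdx m × MatIdx m =>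
        ∑ l : MatIdx m, M l p.2 • (X (p.1, l) : MvPolynomial (MatIdx m × MatIdx m) ℂ))
      (MvPolynomial.aeval (R := ℂ) (fun p : MatIdx m × MatIdx m =>
        ∑ l : MatIdx m, B p.1 l • (X (l, p.2) : MvPolynomial (MatIdx m × MatIdx m) ℂ)) G) := by
  have h : (MvPolynomial.aeval (R := ℂ) (fun p : MatIdx m × MatIdx m =>
        ∑ l : MatIdx m, B p.1 l • (X (l, p.2) : MvPolynomial (MatIdx m × MatIdx m) ℂ))).comp
      (MvPolynomial.aeval (R := ℂ) (fun p : MatIdx m × MatIdx m =>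
        ∑ l : MatIdx m, M l p.2 • (X (p.1, l) : MvPolynomial (MatIdx m × MatIdx m) ℂ)))
      = (MvPolynomial.aeval (R := ℂ) (fun p : MatIdx m × MatIdx m =>
        ∑ l : MatIdx m, M l p.2 • (X (p.1, l) : MvPolynomial (MatIdx m × MatIdx m) ℂ))).comp
      (MvPolynomial.aeval (R := ℂ) (fun p : MatIdx m × MatIdx m =>
        ∑ l : MatIdx m, B p.1 l • (X (l, p.2) : MvPolynomial (MatIdx m × MatIdx m) ℂ))) := by
    refine MvPolynomial.algHom_ext fun p => ?_
    rw [AlgHom.comp_apply, AlgHom.comp_apply, aeval_X, aeval_X, map_sum, map_sum]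
    simp only [map_smul, aeval_X, Finset.smul_sum, smul_smul]
    rw [Finset.sum_comm]
    refine Finset.sum_congr rfl fun l _ => Finset.sum_congr rfl fun r _ => ?_
    rw [mul_comm]
  exact AlgHom.congr_fun h G

/-- Evaluating `G(B·A)` at a point is evaluating `G` at the point `B·p`. [folklore] -/
theorem hwx_eval_leftAct (B : Matrix (MatIdx m) (MatIdx m) ℂ) (G : MvPolynomial (MatIdx m × MatIdx m) ℂ)
    (p : MatIdx m × MatIdx m → ℂ) :
    MvPolynomial.eval p (MvPolynomial.aeval (R := ℂ) (fun q : MatIdx m × MatIdx m =>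
      ∑ l : MatIdx m, B q.1 l • (X (l, q.2) : MvPolynomial (MatIdx m × MatIdx m) ℂ)) G)
    = MvPolynomial.eval (fun q : MatIdx m × MatIdx m => ∑ l : MatIdx m, B q.1 l * p (l, q.2)) G := by
  have h : (MvPolynomial.eval p).comp (MvPolynomial.aeval (R := ℂ) (fun q : MatIdx m × MatIdx m =>
      ∑ l : MatIdx m, B q.1 l • (X (l, q.2) : MvPolynomial (MatIdx m × MatIdx m) ℂ))).toRingHom
      = MvPolynomial.eval (fun q : MatIdx m × MatIdx m => ∑ l : MatIdx m, B q.1 l * p (l, q.2)) := by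
    refine MvPolynomial.ringHom_ext (fun c => ?_) (fun q => ?_)
    · simp
    · simp only [RingHom.comp_apply, AlgHom.toRingHom_eq_coe, RingHom.coe_coe, aeval_X, map_sum, smul_eval,
        eval_X]
  exact RingHom.congr_fun h G

/-- `L_U = {all rows in U}` is stable under `p ↦ B·p` (rows of `B·p` are combinations of rows of `p`). [folklore] -/
theorem hwx_rows_mem_of_rows_mem (U : Submodule ℂ (MatIdx m → ℂ)) (B : Matrix (MatIdx m) (MatIdx m) ℂ)
    {p : MatIdx m × MatIdx m → ℂ} (hp : ∀ j : MatIdx m, (fun i => p (j, i)) ∈ U) (j : MatIdx m) :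
    (fun i => (fun q : MatIdx m × MatIdx m => ∑ l : MatIdx m, B q.1 l * p (l, q.2)) (j, i)) ∈ U := by
  have h : (fun i => (fun q : MatIdx m × MatIdx m => ∑ l : MatIdx m, B q.1 l * p (l, q.2)) (j, i))
      = ∑ l : MatIdx m, B j l • (fun i => p (l, i)) := by
    funext i
    simp [Finset.sum_apply]
  rw [h]
  exact Submodule.sum_mem _ fun l _ => Submodule.smul_mem _ _ (hp l)

/-- A diagonal matrix acts by rescaling the variables row-wise. [folklore] -/
theorem hwx_leftAct_diagonal (d : MatIdx m → ℂ) :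
    MvPolynomial.aeval (R := ℂ) (fun p : MatIdx m × MatIdx m =>
      ∑ l : MatIdx m, Matrix.diagonal d p.1 l • (X (l, p.2) : MvPolynomial (MatIdx m × MatIdx m) ℂ))
    = MvPolynomial.aeval (R := ℂ) (fun p : MatIdx m × MatIdx m =>
      d p.1 • (X p : MvPolynomial (MatIdx m × MatIdx m) ℂ)) := by
  refine MvPolynomial.algHom_ext fun p => ?_
  rw [aeval_X, aeval_X, Finset.sum_eq_single p.1]
  · rw [Matrix.diagonal_apply_eq]
  · exact fun l _ hl => by rw [Matrix.diagonal_apply_ne _ (Ne.symm hl), zero_smul]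
  · exact fun h => absurd (Finset.mem_univ _) h

/-- The left action by `B` is the linear substitution by the block matrix `B̃ (l,i') (j,i) = [i' = i] B j l`. [folklore] -/
theorem hwx_leftAct_eq_linSubst (B : Matrix (MatIdx m) (MatIdx m) ℂ) :
    MvPolynomial.aeval (R := ℂ) (fun p : MatIdx m × MatIdx m =>
      ∑ l : MatIdx m, B p.1 l • (X (l, p.2) : MvPolynomial (MatIdx m × MatIdx m) ℂ))
    = linSubst (MatIdx m × MatIdx m) ℂ
        (Matrix.of fun q p : MatIdx m × MatIdx m => if q.2 = p.2 then B p.1 q.1 else 0) := by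
  refine MvPolynomial.algHom_ext fun p => ?_
  rw [aeval_X, linSubst_X, Fintype.sum_prod_type]
  refine Finset.sum_congr rfl fun l _ => ?_
  simp only [Matrix.of_apply, ite_smul, zero_smul, Finset.sum_ite_eq', Finset.mem_univ, if_true]

/-- Matrix coefficients of the left action are polynomials in the entries of the acting matrix: `ψ (G(B·)) = Q(B)`
(`exists_eval_eq_apply_linSubst` composed with the block embedding). Green, LNM 830, §2.2. [folklore] -/
theorem hwx_exists_eval_eq_apply_leftAct (G : MvPolynomial (MatIdx m × MatIdx m) ℂ)
    (ψ : Module.Dual ℂ (MvPolynomial (MatIdx m × MatIdx m) ℂ)) :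
    ∃ Q : MvPolynomial (MatIdx m × MatIdx m) ℂ, ∀ B : Matrix (MatIdx m) (MatIdx m) ℂ,
      ψ (MvPolynomial.aeval (R := ℂ) (fun p : MatIdx m × MatIdx m =>
        ∑ l : MatIdx m, B p.1 l • (X (l, p.2) : MvPolynomial (MatIdx m × MatIdx m) ℂ)) G)
      = MvPolynomial.eval (fun ij : MatIdx m × MatIdx m => B ij.1 ij.2) Q := by
  obtain ⟨P, hP⟩ := exists_eval_eq_apply_linSubst G ψ
  refine ⟨bind₁ (fun qp : (MatIdx m × MatIdx m) × (MatIdx m × MatIdx m) =>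
    if qp.1.2 = qp.2.2 then X (qp.2.1, qp.1.1) else 0) P, fun B => ?_⟩
  rw [hwx_leftAct_eq_linSubst, hP]
  change _ = eval₂Hom (RingHom.id ℂ) _ (bind₁ _ _)
  rw [eval₂Hom_bind₁]
  change _ = MvPolynomial.eval (fun qp : (MatIdx m × MatIdx m) × (MatIdx m × MatIdx m) =>
    MvPolynomial.eval (fun ij : MatIdx m × MatIdx m => B ij.1 ij.2)
      (if qp.1.2 = qp.2.2 then X (qp.2.1, qp.1.1) else 0)) P
  have hfun : (fun ij : (MatIdx m × MatIdx m) × (MatIdx m × MatIdx m) =>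
      (Matrix.of fun q p : MatIdx m × MatIdx m => if q.2 = p.2 then B p.1 q.1 else 0) ij.1 ij.2)
      = fun qp : (MatIdx m × MatIdx m) × (MatIdx m × MatIdx m) =>
        MvPolynomial.eval (fun ij : MatIdx m × MatIdx m => B ij.1 ij.2)
          (if qp.1.2 = qp.2.2 then X (qp.2.1, qp.1.1) else 0) := by
    funext qp
    simp only [Matrix.of_apply]
    split_ifs <;> simp
  rw [hfun]

end LeftAction

section Torus

variable {m : ℕ}

/-- The inverse of a diagonal element of `GL` is the diagonal matrix of the inverses of its diagonal entries.
[folklore] -/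
theorem hwx_coe_inv_of_isDiagonalGL {t : GL (MatIdx m) ℂ} (ht : IsDiagonalGL t) :
    ((t⁻¹ : GL (MatIdx m) ℂ) : Matrix (MatIdx m) (MatIdx m) ℂ)
      = Matrix.diagonal fun i => ((t : Matrix (MatIdx m) (MatIdx m) ℂ) i i)⁻¹ := by
  have ht' : IsDiagonalGL t⁻¹ := (torusSubgroup (MatIdx m) ℂ).inv_mem ht
  rw [coe_eq_diagonal_of_isDiagonalGL ht']
  congr 1
  funext i
  exact inv_apply_diag_of_isUpperTriangular' ht.isUpperTriangular i

/-- Regrouping a product over the support of a monomial exponent by rows. [folklore] -/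
theorem hwx_prod_support_eq_prod_rows (e : MatIdx m → ℂ) (s : MatIdx m × MatIdx m →₀ ℕ) :
    ∏ q ∈ s.support, e q.1 ^ s q = ∏ i : MatIdx m, e i ^ (∑ q ∈ s.support with q.1 = i, s q) := by
  classical
  rw [← Finset.prod_fiberwise_of_maps_to (s := s.support) (t := Finset.univ) (g := Prod.fst)
    (fun q _ => Finset.mem_univ q.1)]
  refine Finset.prod_congr rfl fun i _ => ?_
  rw [← Finset.prod_pow_eq_pow_sum]
  refine Finset.prod_congr rfl fun q hq => ?_
  rw [(Finset.mem_filter.mp hq).2]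

/-- **Torus weights of the left action.** If `G'(t⁻¹ A) = t^χ G'(A)` for every invertible diagonal `t`, then `χ` is
minus the row-degree vector of any monomial of `G'` (`eq_of_forall_weightChar_eq`). Fulton–Harris §15.5. [folklore] -/
theorem hwx_weight_eq_neg_rowDegrees {χ : Weight (MatIdx m)} {G' : MvPolynomial (MatIdx m × MatIdx m) ℂ}
    (hw : ∀ t : GL (MatIdx m) ℂ, IsDiagonalGL t →
      MvPolynomial.aeval (R := ℂ) (fun p : MatIdx m × MatIdx m =>
        ∑ l : MatIdx m, ((t⁻¹ : GL (MatIdx m) ℂ) : Matrix (MatIdx m) (MatIdx m) ℂ) p.1 l •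
          (X (l, p.2) : MvPolynomial (MatIdx m × MatIdx m) ℂ)) G' = weightChar χ t • G')
    {s : MatIdx m × MatIdx m →₀ ℕ} (hs : coeff s G' ≠ 0) :
    χ = fun i => -((∑ q ∈ s.support with q.1 = i, s q : ℕ) : ℤ) := by
  classical
  refine eq_of_forall_weightChar_eq (k := ℂ) fun t ht => ?_
  have h := hw t ht
  rw [hwx_coe_inv_of_isDiagonalGL ht, hwx_leftAct_diagonal] at h
  have hc := congrArg (coeff s) h
  rw [CutBites.Negative.coeff_aeval_smul_X, coeff_smul, smul_eq_mul] at hc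
  have hprod : ∏ q ∈ s.support, ((t : Matrix (MatIdx m) (MatIdx m) ℂ) q.1 q.1)⁻¹ ^ s q = weightChar χ t :=
    mul_right_cancel₀ hs hc
  rw [← hprod, hwx_prod_support_eq_prod_rows (fun i => ((t : Matrix (MatIdx m) (MatIdx m) ℂ) i i)⁻¹) s,
    weightChar]
  refine Finset.prod_congr rfl fun i _ => ?_
  rw [zpow_neg, zpow_natCast, inv_pow]

end Torus

/-- **Stub 7 — highest-weight extraction** (registered stub of crux stmt-ValiantsHypothesis-12626, line
adjugate-pfaffian-kernel): an `H`-invariant form of degree `D` with a non-zero value at a point all of whose rows lie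
in `U` yields `λ ⊢ D` (`≤ m²` parts) and an `H`-invariant `B`-semi-invariant form of degree `D` and weight
`(dualOfPartition (m*m) λ).toMatIdx`, again non-zero at such a point. See the module docstring. [folklore] -/
theorem stub_hwExtraction (m D : ℕ) (U : Submodule ℂ (MatIdx m → ℂ)) (G : MvPolynomial (MatIdx m × MatIdx m) ℂ)
    (hGh : G.IsHomogeneous D)
    (hGs : ∀ M : Matrix (MatIdx m) (MatIdx m) ℂ, linSubst (MatIdx m) ℂ M (detFormLex ℂ m) = detFormLex ℂ m →
      MvPolynomial.aeval (fun p : MatIdx m × MatIdx m =>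
        ∑ l : MatIdx m, M l p.2 • (X (p.1, l) : MvPolynomial (MatIdx m × MatIdx m) ℂ)) G = G)
    (p : MatIdx m × MatIdx m → ℂ) (hp : ∀ j : MatIdx m, (fun i => p (j, i)) ∈ U)
    (hGp : MvPolynomial.eval p G ≠ 0) :
    ∃ lam : Nat.Partition D, lam.parts.card ≤ m * m ∧
      ∃ G' : MvPolynomial (MatIdx m × MatIdx m) ℂ, G'.IsHomogeneous D ∧
        (∀ M : Matrix (MatIdx m) (MatIdx m) ℂ, linSubst (MatIdx m) ℂ M (detFormLex ℂ m) = detFormLex ℂ m →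
          MvPolynomial.aeval (fun p : MatIdx m × MatIdx m =>
            ∑ l : MatIdx m, M l p.2 • (X (p.1, l) : MvPolynomial (MatIdx m × MatIdx m) ℂ)) G' = G') ∧
        (∀ g : Matrix.GeneralLinearGroup (MatIdx m) ℂ, IsUpperTriangular g →
          MvPolynomial.aeval (fun p : MatIdx m × MatIdx m =>
            ∑ l : MatIdx m, ((g⁻¹ : Matrix.GeneralLinearGroup (MatIdx m) ℂ) : Matrix (MatIdx m) (MatIdx m) ℂ) p.1 l •
              (X (l, p.2) : MvPolynomial (MatIdx m × MatIdx m) ℂ)) G'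
            = weightChar (Weight.dualOfPartition (m * m) lam).toMatIdx g • G') ∧
        ∃ p' : MatIdx m × MatIdx m → ℂ, (∀ j : MatIdx m, (fun i => p' (j, i)) ∈ U) ∧
          MvPolynomial.eval p' G' ≠ 0 := by
  classical
  set Stab : Submodule ℂ (MvPolynomial (MatIdx m × MatIdx m) ℂ) :=
    ⨅ (M : Matrix (MatIdx m) (MatIdx m) ℂ)
      (_ : linSubst (MatIdx m) ℂ M (detFormLex ℂ m) = detFormLex ℂ m),
      LinearMap.ker ((MvPolynomial.aeval (R := ℂ) fun p : MatIdx m × MatIdx m =>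
        ∑ l : MatIdx m, M l p.2 • (X (p.1, l) : MvPolynomial (MatIdx m × MatIdx m) ℂ)).toLinearMap
        - LinearMap.id (R := ℂ) (M := MvPolynomial (MatIdx m × MatIdx m) ℂ)) with hStabdef
  have hmemStab : ∀ F : MvPolynomial (MatIdx m × MatIdx m) ℂ, F ∈ Stab ↔
      ∀ M : Matrix (MatIdx m) (MatIdx m) ℂ, linSubst (MatIdx m) ℂ M (detFormLex ℂ m) = detFormLex ℂ m →
        MvPolynomial.aeval (R := ℂ) (fun p : MatIdx m × MatIdx m =>
          ∑ l : MatIdx m, M l p.2 • (X (p.1, l) : MvPolynomial (MatIdx m × MatIdx m) ℂ)) F = F := by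
    intro F
    simp only [hStabdef, Submodule.mem_iInf, LinearMap.mem_ker, LinearMap.sub_apply, sub_eq_zero,
      AlgHom.toLinearMap_apply, LinearMap.id_coe, id_eq]
  set V : Submodule ℂ (MvPolynomial (MatIdx m × MatIdx m) ℂ) :=
    MvPolynomial.homogeneousSubmodule (MatIdx m × MatIdx m) ℂ D ⊓ Stab with hVdef
  haveI : Module.Finite ℂ ↥(MvPolynomial.homogeneousSubmodule (MatIdx m × MatIdx m) ℂ D) :=
    Module.Finite.iff_fg.mpr (MvPolynomial.homogeneousSubmodule_fg _ ℂ _)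
  haveI : FiniteDimensional ℂ ↥V := Submodule.finiteDimensional_of_le (inf_le_left : V ≤ _)
  have hVstab : ∀ (B : Matrix (MatIdx m) (MatIdx m) ℂ), ∀ F ∈ V,
      MvPolynomial.aeval (R := ℂ) (fun q : MatIdx m × MatIdx m =>
        ∑ l : MatIdx m, B q.1 l • (X (l, q.2) : MvPolynomial (MatIdx m × MatIdx m) ℂ)) F ∈ V := by
    intro B F hF
    obtain ⟨hFh, hFs⟩ := Submodule.mem_inf.mp hF
    refine Submodule.mem_inf.mpr ⟨?_, ?_⟩
    · exact (mem_homogeneousSubmodule _ _).mpr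
        (hwx_leftAct_isHomogeneous B ((mem_homogeneousSubmodule _ _).mp hFh))
    · rw [hmemStab] at hFs ⊢
      intro M hM
      rw [← hwx_leftAct_rightAct_comm, hFs M hM]
  let ρ : Representation ℂ (GL (MatIdx m) ℂ) ↥V :=
    { toFun := fun g => (MvPolynomial.aeval (R := ℂ) (fun q : MatIdx m × MatIdx m =>
          ∑ l : MatIdx m, ((g⁻¹ : GL (MatIdx m) ℂ) : Matrix (MatIdx m) (MatIdx m) ℂ) q.1 l •
            (X (l, q.2) : MvPolynomial (MatIdx m × MatIdx m) ℂ))).toLinearMap.restrict (hVstab _)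
      map_one' := LinearMap.ext fun v => Subtype.ext (by
        simp only [LinearMap.coe_restrict_apply, AlgHom.toLinearMap_apply, Module.End.one_apply, inv_one,
          Units.val_one, hwx_leftAct_one])
      map_mul' := fun g h => LinearMap.ext fun v => Subtype.ext (by
        simp only [LinearMap.coe_restrict_apply, AlgHom.toLinearMap_apply, Module.End.mul_apply,
          hwx_leftAct_leftAct, mul_inv_rev, Units.val_mul]) }
  have hρv : ∀ (g : GL (MatIdx m) ℂ) (v : ↥V), ((ρ g v : ↥V) : MvPolynomial (MatIdx m × MatIdx m) ℂ)
      = MvPolynomial.aeval (R := ℂ) (fun q : MatIdx m × MatIdx m =>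
          ∑ l : MatIdx m, ((g⁻¹ : GL (MatIdx m) ℂ) : Matrix (MatIdx m) (MatIdx m) ℂ) q.1 l •
            (X (l, q.2) : MvPolynomial (MatIdx m × MatIdx m) ℂ)) (v : MvPolynomial (MatIdx m × MatIdx m) ℂ) :=
    fun g v => rfl
  have hρrat : IsRationalRep ρ := by
    refine isRationalRep_of_forall_exists_eval_inv fun v φ => ?_
    obtain ⟨ψ, hψ⟩ := LinearMap.exists_extend φ
    obtain ⟨Q, hQ⟩ := hwx_exists_eval_eq_apply_leftAct (v : MvPolynomial (MatIdx m × MatIdx m) ℂ) ψ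
    refine ⟨Q, fun g => ?_⟩
    rw [← hQ ((g⁻¹ : GL (MatIdx m) ℂ) : Matrix (MatIdx m) (MatIdx m) ℂ), ← hρv, ← hψ]
    rfl
  set L : Set (MatIdx m × MatIdx m → ℂ) := {q | ∀ j : MatIdx m, (fun i => q (j, i)) ∈ U} with hLdef
  let N : Submodule ℂ ↥V := ((MvPolynomial.vanishingIdeal ℂ L).restrictScalars ℂ).comap V.subtype
  have hmemN : ∀ v : ↥V, v ∈ N ↔ ∀ q ∈ L, MvPolynomial.eval q (v : MvPolynomial (MatIdx m × MatIdx m) ℂ) = 0 := by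
    intro v
    simp only [N, Submodule.mem_comap, Submodule.restrictScalars_mem, mem_vanishingIdeal_iff,
      Submodule.subtype_apply, aeval_eq_eval]
  have hNstab : ∀ (g : GL (MatIdx m) ℂ), ∀ v ∈ N, ρ g v ∈ N := by
    intro g v hv
    rw [hmemN] at hv ⊢
    intro q hq
    rw [hρv, hwx_eval_leftAct]
    exact hv _ (fun j => hwx_rows_mem_of_rows_mem U _ hq j)
  have hGV : G ∈ V := Submodule.mem_inf.mpr ⟨(mem_homogeneousSubmodule _ _).mpr hGh, (hmemStab G).mpr hGs⟩
  have hNtop : N ≠ ⊤ := by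
    intro h
    have hGN : (⟨G, hGV⟩ : ↥V) ∈ N := h ▸ Submodule.mem_top
    exact hGp ((hmemN _).mp hGN p hp)
  obtain ⟨χ, v, hv, hvN⟩ := hwx_exists_mem_highestWeightSpace_not_mem ρ hρrat N hNstab hNtop
  have hv0 : v ≠ 0 := fun h => hvN (h ▸ N.zero_mem)
  have hG'h : (v : MvPolynomial (MatIdx m × MatIdx m) ℂ).IsHomogeneous D :=
    (mem_homogeneousSubmodule _ _).mp (Submodule.mem_inf.mp v.2).1
  have hG's := (hmemStab _).mp (Submodule.mem_inf.mp v.2).2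
  have hG'w : ∀ g : GL (MatIdx m) ℂ, IsUpperTriangular g →
      MvPolynomial.aeval (R := ℂ) (fun q : MatIdx m × MatIdx m =>
        ∑ l : MatIdx m, ((g⁻¹ : GL (MatIdx m) ℂ) : Matrix (MatIdx m) (MatIdx m) ℂ) q.1 l •
          (X (l, q.2) : MvPolynomial (MatIdx m × MatIdx m) ℂ)) (v : MvPolynomial (MatIdx m × MatIdx m) ℂ)
        = weightChar χ g • (v : MvPolynomial (MatIdx m × MatIdx m) ℂ) := by
    intro g hg
    rw [← hρv, hv g hg, Submodule.coe_smul]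
  have hG'0 : (v : MvPolynomial (MatIdx m × MatIdx m) ℂ) ≠ 0 := fun h =>
    hv0 (Subtype.ext (h.trans (Submodule.coe_zero (p := V)).symm))
  obtain ⟨p', hp'L, hp'⟩ : ∃ p' ∈ L, MvPolynomial.eval p' (v : MvPolynomial (MatIdx m × MatIdx m) ℂ) ≠ 0 := by
    by_contra hcon; push Not at hcon; exact hvN ((hmemN v).mpr hcon)
  have hdom : χ.IsDominant := isDominant_of_mem_highestWeightSpace hρrat hv hv0
  obtain ⟨s, hs⟩ := MvPolynomial.ne_zero_iff.mp hG'0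
  have hχ : χ = fun i => -((∑ q ∈ s.support with q.1 = i, s q : ℕ) : ℤ) :=
    hwx_weight_eq_neg_rowDegrees (fun t ht => hG'w t ht.isUpperTriangular) hs
  have hdeg : (∑ q ∈ s.support, s q) = D := by
    have := hG'h (mem_support_iff.mp (mem_support_iff.mpr hs))
    simpa [Finsupp.weight_apply, Finsupp.sum] using this
  have hnonpos : ∀ i, χ i ≤ 0 := fun i => by rw [hχ]; simp only [Left.neg_nonpos_iff]; positivity
  have hsize : χ.size = -((1 * D : ℕ) : ℤ) := by
    rw [Weight.size, hχ, one_mul, ← hdeg]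
    simp only [Finset.sum_neg_distrib]
    rw [← Nat.cast_sum, Finset.sum_fiberwise_of_maps_to (g := Prod.fst) (fun q _ => Finset.mem_univ q.1)]
  obtain ⟨lam, hlamN, hlam⟩ :=
    Weight.exists_eq_dualOfPartition_comp_of_nonpos (matIdxEquiv m) χ hnonpos hdom hsize
  refine ⟨⟨lam.parts, lam.parts_pos, by rw [lam.parts_sum, mul_one]⟩, hlamN,
    (v : MvPolynomial (MatIdx m × MatIdx m) ℂ), hG'h, hG's, fun g hg => ?_, p', hp'L, hp'⟩
  have hχ' : (Weight.dualOfPartition (m * m)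
      (⟨lam.parts, lam.parts_pos, by rw [lam.parts_sum, mul_one]⟩ : Nat.Partition D)).toMatIdx = χ := by
    rw [hlam]
    rfl
  rw [hχ', hG'w g hg]

end Summit.ValiantsHypothesis.ValiantsHypothesis.Theorems.CutBitesAdjugate
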